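import Literature.Geometry.Kaehler.ComplexTorusMaximalCMSubfieldCenter
import Mathlib.FieldTheory.Galois.Basic
import HarnessLib

/-!
# A subfield `E ⊇ 𝒞` of `End⁰(X)` containing the centre: the multiplicities `n_σ` are invariant under
# `Gal(E/𝒞)` (Zarhin, *The endomorphism rings of jacobians of cyclic covers of the projective line*,
# Math. Proc. Cambridge Philos. Soc. 136 (2004), Theorem 2.3 — its Galois clause, at torus level)

Layer `Literature/Geometry/Kaehler`, namespaces `Literature.Geometry.Kaehler.MaximalSubfield` (§1, generic
algebra) and `Literature.Geometry.Kaehler.ComplexTorus` (§2–§3); lane `lit-hodgefound` (Track 2 foundations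
library), seat p11, generation 16, row g16-#5. Sequel, BY NAME (nothing restated), of this seat's
`ComplexTorusMaximalCMSubfieldCenter.lean` (g16-#2), whose engine
`finrank_iInf_eigenspace_analyticRepHom_comp_algEquiv` ("the multiplicities are invariant under the
automorphisms of `K` over the centre") was stated for `K ⊆ End⁰(X)` MAXIMAL COMMUTATIVE. The published form
(Zarhin 2004, Thm. 2.3) needs only `E ⊇ 𝒞_Z` — the centre lies in the subfield — and that is what is proved
here, by the same Skolem–Noether road: all g16-#2's argument used of maximal commutativity was that CENTRAL
elements (central idempotents, the centre) lie in `f(K)`.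

## Source, verbatim

Yu. G. Zarhin, *The endomorphism rings of jacobians of cyclic covers of the projective line*, Math. Proc.
Cambridge Philos. Soc. 136 (2004) 257–267 (held text `paper:arxiv-math_0103203`), §2, p0004: "Throughout
this section we assume that `Z` is a complex abelian variety of positive dimension. […] We write `𝒞_Z` for
the center of `End⁰(Z)`. […] Suppose `E` is a subfield of `End⁰(Z)` that contains the identity map. […]
`Lie(Z)_σ = ℂ_σ Lie(Z) = {x ∈ Lie(Z) ∣ ex = σ(e)x ∀ e ∈ E}`. Let us put
`n_σ = n_σ(Z,E) = dim_ℂ Lie(Z)_σ`. […] **Theorem 2.3.** Suppose `E` contains `𝒞_Z`. Then the tuple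
`(n_σ)_{σ ∈ Σ_E} ∈ ∏_{σ∈Σ_E} ℂ_σ = E ⊗_ℚ ℂ` lies in `𝒞_Z ⊗_ℚ ℂ`. In particular, if `E/ℚ` is Galois and
`𝒞_Z ≠ E` then there exists a nontrivial automorphism `κ : E → E` such that `n_σ = n_{σκ}` for all
`σ ∈ Σ_E`. *Proof.* The inclusion `𝒞_Z ⊂ E` implies that `𝒞_Z` is a field. […]" (the printed proof computes
`(−n_σ)_σ` as the `E_ℂ`-trace of the Hodge operator `f_H ∈ mt_ℂ` and uses `Tr_E(mt^{ss}) = 0`,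
`Tr_E(𝔠) ⊂ 𝒞_Z` for the reductive Mumford–Tate Lie algebra `mt = mt^{ss} ⊕ 𝔠`); p0005: "notice that its
assumptions imply that `E/𝒞_Z` is a nontrivial Galois extension. If `κ : E → E` is a non-identity element
of the Galois group `Gal(E/𝒞_Z)` then […] `u_σ = u_{σκ}`". Restated as Theorem 4.1 of Yu. G. Zarhin,
*Superelliptic jacobians* (2006; held `paper:arxiv-math_0601072`, p0007): "If `E/ℚ` is Galois,
`E ⊃ 𝒞_Z` and `𝒞_Z ≠ E` then there exists a nontrivial automorphism `κ : E → E` such that `n_σ = n_{σκ}`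
for all `σ ∈ Σ_E`. Proof. See [ZarhinCamb]."

## Statement formalised (torus level) and deviation

`(X = E/Φ(ℤ^ι), η)` a polarised complex torus, `K` a number field with `f : K →ₐ[ℚ] M_ι(ℚ)` into
`End⁰(X) = endAlgRat Φ` (p13's convention), and the hypothesis **"`E ⊇ 𝒞_Z`"**:
`hcen : ∀ z ∈ endAlgRat Φ, (∀ B ∈ endAlgRat Φ, B z = z B) → z ∈ Set.range f`.

* `finrank_iInf_eigenspace_analyticRepHom_comp_algEquiv_of_center_le` — for every `ℚ`-automorphism `κ`
  of `K` fixing (the pull-back of) `𝒞_Z` pointwise, `n_{σ∘κ} = n_σ` for all `σ` (this is "`n_σ = n_{σκ}`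
  for `κ ∈ Gal(E/𝒞_Z)`", the content of the printed second assertion, for any `K`);
* **`exists_algEquiv_ne_one_forall_finrank_eq`** — THEOREM 2.3, Galois clause, AS PRINTED: `K/ℚ` Galois
  (`IsGalois ℚ K`), `𝒞_Z ⊆ f(K)`, `𝒞_Z ≠ f(K)` (some `f(k)` is not central) ⟹ a NON-TRIVIAL `κ` with
  `n_{σ∘κ} = n_σ` for all `σ`;
* `forall_center_of_forall_algEquiv` — the contrapositive used downstream ("If `E ⊃ 𝒞_Z` then
  `𝒞_Z = ℚ(ζ_q)`", Zarhin 2006 Thm. 4.2 (a), whose curve-side combinatorics of the `n_{σ_i} = [ni/q]` is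
  not a torus statement): if every non-trivial `κ` moves some multiplicity, then `f(K) = 𝒞_Z` (every
  `f(k)` is central) — in particular `n_σ` pairwise distinct suffices (`forall_center_of_injective`).

§1 generalises g16-#2's algebra to the hypothesis "central elements lie in `f(K)`":
`isSimpleRing_of_center_subset_range`, `exists_units_forall_algHom_algEquiv_eq_conj_of_center_subset_range`.

DEVIATION (recorded, as for g16-#2): the print proves the first assertion `(n_σ)_σ ∈ 𝒞_Z ⊗ ℂ` through the
Mumford–Tate Lie algebra and deduces the Galois clause; we prove the Galois clause (indeed
`n_{σ∘κ} = n_σ` for every `κ ∈ Aut(K/𝒞_Z)`, Galois or not) directly: `End⁰(X)` is semisimple with centre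
`𝒞_Z ⊆ f(K)` a field, hence central simple over `𝒞_Z`; `κ` is `𝒞_Z`-linear, so Skolem–Noether
(g16-#1) gives `u ∈ End⁰(X)^×` with `f(κ k) = u f(k) u⁻¹`, and `ρ_a(u)` carries `T_σ` into `T_{σ∘κ⁻¹}`.
NOT HERE: the first assertion of Thm. 2.3 in full (for `E/𝒞_Z` not normal it says more: `n_σ` depends
only on `σ|_{𝒞_Z}`), Remark 2.1 (`n_σ + n_σ' = d`, p13's file), Theorem 4.2 of the 2006 paper.

## References

* Yu. G. Zarhin, The endomorphism rings of jacobians of cyclic covers of the projective line, Math. Proc.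
  Cambridge Philos. Soc. 136 (2004), §2 Thm. 2.3 and proof (arXiv math/0103203, p0004–p0005)
  [Zarhin2004EndomorphismRingsCyclicCovers].
* Yu. G. Zarhin, Superelliptic jacobians (2006), §4 Thm. 4.1 (arXiv math/0601072, p0007).
* [Voight2021] J. Voight, Quaternion Algebras (2021), §7.7 Main Thm. 7.7.1.
-/

noncomputable section

open Module NumberField
open scoped IntermediateField

universe u

namespace Literature.Geometry.Kaehler

/-! ## §1 Generic algebra under "central elements lie in `f(K)`" -/

namespace MaximalSubfield

/-- If a field `K` is embedded in a semisimple algebra `A` so that every CENTRAL element of `A` lies in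
`f(K)`, then `A` is simple ("The inclusion `𝒞_Z ⊂ E` implies that `𝒞_Z` is a field": a central idempotent
lies in the field `f(K)`, so it is `0` or `1`). [cite: Zarhin2004EndomorphismRingsCyclicCovers, §2 proof of Thm 2.3 ("`𝒞_Z` is a field", p0004)] -/
theorem isSimpleRing_of_center_subset_range {F₀ : Type*} [Field F₀] {A : Type u} [Ring A] [Algebra F₀ A]
    [IsSemisimpleRing A] [Nontrivial A] {K : Type*} [Field K] [Algebra F₀ K] (f : K →ₐ[F₀] A)
    (hcen : ∀ z : A, (∀ a : A, a * z = z * a) → z ∈ Set.range f) : IsSimpleRing A := by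
  refine isSimpleRing_of_forall_central_idempotent fun z hz hc ↦ ?_
  obtain ⟨k, rfl⟩ := hcen z hc
  have hk : k * k = k := (f : K →+* A).injective (by rw [map_mul]; exact hz)
  rcases eq_or_ne k 0 with h | h
  · exact Or.inl (by rw [h, map_zero])
  · refine Or.inr ?_
    have h1 : k = 1 := mul_left_cancel₀ h (by rw [hk, mul_one])
    rw [h1, map_one]

/-- **Skolem–Noether over the centre, for a subfield containing the centre.** Let `A` be a
finite-dimensional semisimple `F₀`-algebra and `f : K ↪ A` an embedded field such that every central
element of `A` lies in `f(K)` ("`E ⊇ 𝒞_Z`"); then `A` is central simple over the field `C = f⁻¹𝒞`, and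
every automorphism `τ` of `K` fixing `C` pointwise is induced by an inner automorphism of `A`:
`f(τ k) = u f(k) u⁻¹`. [cite: Voight2021, §7.7 Main Thm. 7.7.1 (PDF p0127)]
[cite: Zarhin2004EndomorphismRingsCyclicCovers, §2 Thm 2.3, second assertion (p0004–p0005)] -/
theorem exists_units_forall_algHom_algEquiv_eq_conj_of_center_subset_range {F₀ : Type*} [Field F₀]
    {A : Type u} [Ring A] [Algebra F₀ A] [FiniteDimensional F₀ A] [IsSemisimpleRing A]
    {K : Type*} [Field K] [Algebra F₀ K] [FiniteDimensional F₀ K] (f : K →ₐ[F₀] A)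
    (hcen : ∀ z : A, (∀ a : A, a * z = z * a) → z ∈ Set.range f) (τ : K ≃ₐ[F₀] K)
    (hτ : ∀ k : K, (∀ a : A, a * f k = f k * a) → τ k = k) :
    ∃ u : Aˣ, ∀ k : K, f (τ k) = u * f k * ↑u⁻¹ := by
  classical
  rcases subsingleton_or_nontrivial A with hA | hA
  · exact ⟨1, fun k ↦ Subsingleton.elim _ _⟩
  let C₀ : Subalgebra F₀ K := (Subalgebra.center F₀ A).comap f
  have hC₀ : ∀ k : K, k ∈ C₀ ↔ ∀ a : A, a * f k = f k * a := fun k ↦ by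
    change f k ∈ Subalgebra.center F₀ A ↔ _
    exact Subalgebra.mem_center_iff
  haveI : Algebra.IsAlgebraic F₀ K := Algebra.IsAlgebraic.of_finite F₀ K
  let C : IntermediateField F₀ K := C₀.toIntermediateField' (Subalgebra.isField_of_algebraic C₀)
  have hC : ∀ k : K, k ∈ C ↔ ∀ a : A, a * f k = f k * a := fun k ↦ by
    rw [← hC₀]; exact Iff.rfl
  letI : Algebra C A := ((f : K →+* A).comp (algebraMap C K)).toAlgebra' fun c x ↦
    (((hC (c : K)).1 c.2) x).symm
  have halg : ∀ c : C, algebraMap C A c = f (c : K) := fun c ↦ rfl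
  haveI : IsScalarTower F₀ C A := IsScalarTower.of_algebraMap_eq fun r ↦ by
    rw [halg]
    change algebraMap F₀ A r = f (algebraMap F₀ K r)
    rw [AlgHom.commutes]
  haveI : Module.Finite C A := Module.Finite.of_restrictScalars_finite F₀ C A
  haveI : IsSimpleRing A := isSimpleRing_of_center_subset_range f hcen
  haveI : Algebra.IsCentral C A := ⟨fun z hz ↦ by
    rw [Subalgebra.mem_center_iff] at hz
    obtain ⟨k, rfl⟩ := hcen z fun a ↦ (hz a)
    exact Algebra.mem_bot.2 ⟨⟨k, (hC k).2 hz⟩, rfl⟩⟩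
  let fC : K →ₐ[C] A := { (f : K →+* A) with commutes' := fun c ↦ rfl }
  let τC : K ≃ₐ[C] K :=
    { τ.toRingEquiv with commutes' := fun c ↦ hτ (c : K) ((hC (c : K)).1 c.2) }
  obtain ⟨u, hu⟩ :=
    Literature.RingTheory.CentralSimple.exists_units_forall_algHom_algEquiv_eq_conj fC τC
  exact ⟨u, fun k ↦ hu k⟩

end MaximalSubfield

/-! ## §2 Torus level: the multiplicities are invariant under `Aut(K/𝒞_Z)` when `𝒞_Z ⊆ f(K)` -/

namespace ComplexTorus

open MaximalSubfield

variable {ι : Type*} [Fintype ι] [DecidableEq ι] {E : Type*} [NormedAddCommGroup E] [NormedSpace ℂ E]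
  [FiniteDimensional ℂ E] (Φ : (ι → ℝ) ≃L[ℝ] E) {η : E [⋀^Fin 2]→L[ℝ] ℝ}
  {K : Type*} [Field K] [NumberField K] (f : K →ₐ[ℚ] Matrix ι ι ℚ) (hf : ∀ x, f x ∈ endAlgRat Φ)

/-- **`n_σ = n_{σκ}` for `κ ∈ Aut(E/𝒞_Z)`** (the content of the second assertion of Thm. 2.3, for any
number field): for a polarised complex torus `(X, η)`, a number field `f : K ↪ End⁰(X)` CONTAINING THE
CENTRE (`𝒞_Z ⊆ f(K)`), and a `ℚ`-automorphism `κ` of `K` fixing the pull-back of `𝒞_Z` pointwise,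
`n_{σ∘κ} = n_σ` for every embedding `σ : K ↪ ℂ`.
[cite: Zarhin2004EndomorphismRingsCyclicCovers, §2 Thm 2.3, second assertion, and its proof (p0004–p0005)] -/
theorem finrank_iInf_eigenspace_analyticRepHom_comp_algEquiv_of_center_le (hη : IsRiemannForm Φ η)
    (hcen : ∀ z ∈ endAlgRat Φ, (∀ B ∈ endAlgRat Φ, B * z = z * B) → z ∈ Set.range f)
    (κ : K ≃ₐ[ℚ] K) (hκ : ∀ k : K, (∀ B ∈ endAlgRat Φ, B * f k = f k * B) → κ k = k) (σ : K →+* ℂ) :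
    finrank ℂ ↥(⨅ y : K, Module.End.eigenspace
        ((analyticRepHom Φ ⟨f y, hf y⟩ : E →L[ℂ] E) : E →ₗ[ℂ] E) (σ.comp (κ : K →+* K) y)) =
      finrank ℂ ↥(⨅ y : K, Module.End.eigenspace
        ((analyticRepHom Φ ⟨f y, hf y⟩ : E →L[ℂ] E) : E →ₗ[ℂ] E) (σ y)) := by
  classical
  haveI : IsSemisimpleRing (endAlgRat Φ) := hη.isSemisimpleRing_endAlgRat
  let f' : K →ₐ[ℚ] endAlgRat Φ := f.codRestrict (endAlgRat Φ) hf
  let g : endAlgRat Φ →+* Module.End ℂ E :=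
    ContinuousLinearMap.toLinearMapRingHom.comp (analyticRepHom Φ)
  have hcen' : ∀ a : endAlgRat Φ, (∀ b : endAlgRat Φ, b * a = a * b) → a ∈ Set.range f' := by
    intro a ha
    obtain ⟨k, hk⟩ := hcen a.1 a.2 fun B hB ↦ congrArg Subtype.val (ha ⟨B, hB⟩)
    exact ⟨k, Subtype.ext hk⟩
  have hfix : ∀ (ψ : K ≃ₐ[ℚ] K), (∀ k : K, (∀ B ∈ endAlgRat Φ, B * f k = f k * B) → ψ k = k) →
      ∀ k : K, (∀ a : endAlgRat Φ, a * f' k = f' k * a) → ψ k = k :=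
    fun ψ hψ k hk ↦ hψ k fun B hB ↦ congrArg Subtype.val (hk ⟨B, hB⟩)
  have hle : ∀ (ψ : K ≃ₐ[ℚ] K), (∀ k : K, (∀ B ∈ endAlgRat Φ, B * f k = f k * B) → ψ k = k) →
      ∀ φ : K →+* ℂ,
      finrank ℂ ↥(⨅ y : K, Module.End.eigenspace (g (f' y)) (φ y)) ≤
        finrank ℂ ↥(⨅ y : K, Module.End.eigenspace (g (f' y)) (φ.comp (ψ.symm : K →+* K) y)) := by
    intro ψ hψ φ
    obtain ⟨u, hu⟩ :=
      exists_units_forall_algHom_algEquiv_eq_conj_of_center_subset_range f' hcen' ψ (hfix ψ hψ)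
    have h := finrank_iInf_eigenspace_le_of_units_conj g u (fun y ↦ f' y) (fun y ↦ f' (ψ y))
      (fun y ↦ by rw [hu y, Units.inv_mul_cancel_right]) φ
    let G : K → Submodule ℂ E := fun y ↦
      Module.End.eigenspace (g (f' y)) (φ.comp (ψ.symm : K →+* K) y)
    have hre : (⨅ y : K, Module.End.eigenspace (g (f' (ψ y))) (φ y)) =
        ⨅ y : K, Module.End.eigenspace (g (f' y)) (φ.comp (ψ.symm : K →+* K) y) := by
      calc (⨅ y : K, Module.End.eigenspace (g (f' (ψ y))) (φ y))
          = ⨅ y : K, G ((ψ : K ≃ K) y) := iInf_congr fun y ↦ by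
            change Module.End.eigenspace (g (f' (ψ y))) (φ y) =
              Module.End.eigenspace (g (f' (ψ y))) (φ (ψ.symm (ψ y)))
            rw [ψ.symm_apply_apply]
        _ = ⨅ y : K, G y := Equiv.iInf_comp (ψ : K ≃ K)
    rwa [hre] at h
  have hκ' : ∀ k : K, (∀ B ∈ endAlgRat Φ, B * f k = f k * B) → κ.symm k = k := by
    intro k hk
    conv_lhs => rw [← hκ k hk]
    exact κ.symm_apply_apply k
  have key : ∀ φ : K →+* ℂ,
      finrank ℂ ↥(⨅ y : K, Module.End.eigenspace
        ((analyticRepHom Φ ⟨f y, hf y⟩ : E →L[ℂ] E) : E →ₗ[ℂ] E) (φ y)) =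
      finrank ℂ ↥(⨅ y : K, Module.End.eigenspace (g (f' y)) (φ y)) := fun φ ↦ rfl
  rw [key (σ.comp (κ : K →+* K)), key σ]
  apply le_antisymm
  · refine (hle κ hκ (σ.comp (κ : K →+* K))).trans (le_of_eq ?_)
    refine congrArg (fun S : Submodule ℂ E ↦ finrank ℂ ↥S) (iInf_congr fun y ↦ ?_)
    change Module.End.eigenspace (g (f' y)) (σ (κ (κ.symm y))) = _
    rw [κ.apply_symm_apply]
  · refine (hle κ.symm hκ' σ).trans (le_of_eq ?_)
    refine congrArg (fun S : Submodule ℂ E ↦ finrank ℂ ↥S) (iInf_congr fun y ↦ ?_)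
    change Module.End.eigenspace (g (f' y)) (σ (κ.symm.symm y)) = _
    rw [κ.symm_symm]
    rfl

/-! ## §3 Theorem 2.3, Galois clause: a NON-TRIVIAL `κ` when `K/ℚ` is Galois and `𝒞_Z ≠ f(K)` -/

/-- **Zarhin 2004, Theorem 2.3 (second assertion), at torus level.** "If `E/ℚ` is Galois and `𝒞_Z ≠ E`
then there exists a nontrivial automorphism `κ : E → E` such that `n_σ = n_{σκ}` for all `σ ∈ Σ_E`": for a
polarised complex torus `(X, η)` and a Galois number field `f : K ↪ End⁰(X)` with `𝒞_Z ⊆ f(K)` and some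
`f(k)` NOT central, there is `κ ≠ 1` in `Gal(K/ℚ)` with `n_{σ∘κ} = n_σ` for every `σ` (indeed every
non-trivial element of `Gal(K/f⁻¹𝒞_Z) ≠ 1` works).
[cite: Zarhin2004EndomorphismRingsCyclicCovers, §2 Thm 2.3 (p0004) and its proof (p0005)] -/
theorem exists_algEquiv_ne_one_forall_finrank_eq [IsGalois ℚ K] (hη : IsRiemannForm Φ η)
    (hcen : ∀ z ∈ endAlgRat Φ, (∀ B ∈ endAlgRat Φ, B * z = z * B) → z ∈ Set.range f)
    (hne : ∃ k : K, ¬ ∀ B ∈ endAlgRat Φ, B * f k = f k * B) :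
    ∃ κ : K ≃ₐ[ℚ] K, κ ≠ 1 ∧ ∀ σ : K →+* ℂ,
      finrank ℂ ↥(⨅ y : K, Module.End.eigenspace
          ((analyticRepHom Φ ⟨f y, hf y⟩ : E →L[ℂ] E) : E →ₗ[ℂ] E) (σ.comp (κ : K →+* K) y)) =
        finrank ℂ ↥(⨅ y : K, Module.End.eigenspace
          ((analyticRepHom Φ ⟨f y, hf y⟩ : E →L[ℂ] E) : E →ₗ[ℂ] E) (σ y)) := by
  classical
  -- the centre, pulled back to `K`, is a PROPER intermediate field `C`
  let f' : K →ₐ[ℚ] endAlgRat Φ := f.codRestrict (endAlgRat Φ) hf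
  let C₀ : Subalgebra ℚ K := (Subalgebra.center ℚ (endAlgRat Φ)).comap f'
  have hC₀ : ∀ k : K, k ∈ C₀ ↔ ∀ B ∈ endAlgRat Φ, B * f k = f k * B := fun k ↦ by
    change f' k ∈ Subalgebra.center ℚ (endAlgRat Φ) ↔ _
    rw [Subalgebra.mem_center_iff]
    exact ⟨fun h B hB ↦ congrArg Subtype.val (h ⟨B, hB⟩), fun h a ↦ Subtype.ext (h a.1 a.2)⟩
  let C : IntermediateField ℚ K := C₀.toIntermediateField' (Subalgebra.isField_of_algebraic C₀)
  have hC : ∀ k : K, k ∈ C ↔ ∀ B ∈ endAlgRat Φ, B * f k = f k * B := fun k ↦ by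
    rw [← hC₀]; exact Iff.rfl
  have hCtop : C ≠ ⊤ := by
    obtain ⟨k, hk⟩ := hne
    intro h
    exact hk ((hC k).1 (h ▸ IntermediateField.mem_top))
  -- `K/C` is a non-trivial Galois extension: pick `κ₀ ≠ 1` in `Gal(K/C)`
  haveI : IsGalois C K := IsGalois.tower_top_of_isGalois ℚ C K
  have hcard : 1 < Nat.card (K ≃ₐ[C] K) := by
    rw [IsGalois.card_aut_eq_finrank]
    have hpos : 0 < finrank C K := finrank_pos
    rcases Nat.lt_or_ge 1 (finrank C K) with h | h
    · exact h
    · exfalso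
      have h1 : finrank C K = 1 := le_antisymm h hpos
      apply hCtop
      exact IntermediateField.eq_of_le_of_finrank_eq' le_top
        (by rw [h1, IntermediateField.finrank_top])
  haveI : Nontrivial (K ≃ₐ[C] K) := (Finite.one_lt_card_iff_nontrivial).1 hcard
  obtain ⟨κ₀, hκ₀⟩ := exists_ne (1 : K ≃ₐ[C] K)
  let κ : K ≃ₐ[ℚ] K := κ₀.restrictScalars ℚ
  have hκ : ∀ x, κ x = κ₀ x := fun x ↦ rfl
  refine ⟨κ, fun h1 ↦ hκ₀ (AlgEquiv.ext fun x ↦ ?_), fun σ ↦ ?_⟩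
  · rw [← hκ, h1, AlgEquiv.one_apply, AlgEquiv.one_apply]
  · refine finrank_iInf_eigenspace_analyticRepHom_comp_algEquiv_of_center_le Φ f hf hη hcen κ
      (fun k hk ↦ ?_) σ
    rw [hκ]
    exact κ₀.commutes (⟨k, (hC k).2 hk⟩ : C)

/-- **Contrapositive, as used downstream** ("If `E ⊃ 𝒞_Z` then `𝒞_Z = ℚ(ζ_q)`", Zarhin 2006 Thm. 4.2
(a), minus its curve-side combinatorics): for `(X, η)` polarised and a Galois number field
`f : K ↪ End⁰(X)` containing the centre, if every NON-TRIVIAL `κ ∈ Gal(K/ℚ)` changes some multiplicity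
(`n_{σ∘κ} ≠ n_σ` for some `σ`), then `f(K) = 𝒞_Z`: every `f(k)` is central.
[cite: Zarhin2004EndomorphismRingsCyclicCovers, §2 Thm 2.3 (p0004)] -/
theorem forall_center_of_forall_algEquiv [IsGalois ℚ K] (hη : IsRiemannForm Φ η)
    (hcen : ∀ z ∈ endAlgRat Φ, (∀ B ∈ endAlgRat Φ, B * z = z * B) → z ∈ Set.range f)
    (hmove : ∀ κ : K ≃ₐ[ℚ] K, κ ≠ 1 → ∃ σ : K →+* ℂ,
      finrank ℂ ↥(⨅ y : K, Module.End.eigenspace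
          ((analyticRepHom Φ ⟨f y, hf y⟩ : E →L[ℂ] E) : E →ₗ[ℂ] E) (σ.comp (κ : K →+* K) y)) ≠
        finrank ℂ ↥(⨅ y : K, Module.End.eigenspace
          ((analyticRepHom Φ ⟨f y, hf y⟩ : E →L[ℂ] E) : E →ₗ[ℂ] E) (σ y))) :
    ∀ k : K, ∀ B ∈ endAlgRat Φ, B * f k = f k * B := by
  by_contra h
  push Not at h
  obtain ⟨k, B, hB, hkB⟩ := h
  obtain ⟨κ, hκ1, hκ⟩ := exists_algEquiv_ne_one_forall_finrank_eq Φ f hf hη hcen ⟨k, fun h ↦ hkB (h B hB)⟩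
  obtain ⟨σ, hσ⟩ := hmove κ hκ1
  exact hσ (hκ σ)

/-- **Pairwise distinct multiplicities force `f(K) = 𝒞_Z`**: if `σ ↦ n_σ` is injective on the embeddings
of the Galois field `K ⊇ 𝒞_Z`, no non-trivial `κ` can preserve all multiplicities (`σ ∘ κ ≠ σ`), so every
`f(k)` is central. [cite: Zarhin2004EndomorphismRingsCyclicCovers, §2 Thm 2.3 (p0004)] -/
theorem forall_center_of_injective [IsGalois ℚ K] (hη : IsRiemannForm Φ η)
    (hcen : ∀ z ∈ endAlgRat Φ, (∀ B ∈ endAlgRat Φ, B * z = z * B) → z ∈ Set.range f)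
    (hinj : Function.Injective fun σ : K →+* ℂ ↦
      finrank ℂ ↥(⨅ y : K, Module.End.eigenspace
          ((analyticRepHom Φ ⟨f y, hf y⟩ : E →L[ℂ] E) : E →ₗ[ℂ] E) (σ y))) :
    ∀ k : K, ∀ B ∈ endAlgRat Φ, B * f k = f k * B := by
  refine forall_center_of_forall_algEquiv Φ f hf hη hcen fun κ hκ1 ↦ ?_
  -- any embedding is moved by `κ ≠ 1`
  obtain ⟨σ⟩ : Nonempty (K →+* ℂ) := inferInstance
  refine ⟨σ, fun h ↦ hκ1 ?_⟩
  have hστ : σ.comp (κ : K →+* K) = σ := hinj h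
  apply AlgEquiv.ext
  intro x
  apply σ.injective
  change (σ.comp (κ : K →+* K)) x = σ x
  rw [hστ]

end ComplexTorus

end Literature.Geometry.Kaehler
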